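import Literature.NumberTheory.Sieve.QuadraticRootsLevelDeck
import Literature.NumberTheory.Sieve.QuadraticRootsLevelCosets
import Mathlib.Analysis.SpecialFunctions.SmoothTransition
import HarnessLib

/-!
# Tóth's method for the Weyl sums of roots of `ax² + bx + c` (`Δ > 0`): partition of unity, unfolding, and the pre-Poisson identity

This module has three parts: (1) Tóth's partition of unity over the automorphs; (2) Tóth's
unfolding (the `T`-classes of a class as a weighted sum over primitive vectors); (3) the Weyl
sums for the roots as Tóth-weighted sums over coprime pairs (Hooley's identity, the pre-Poisson
identity `weylSum_eq_sum_tothSum`).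

## Part 1. Tóth's partition of unity over the automorphs of an indefinite form

Topic `Literature/NumberTheory/Sieve`.  Á. Tóth, *Roots of quadratic congruences*, IMRN 2000,
handles the infinite group of automorphs of an indefinite binary quadratic form in the Weyl sums
for roots of `f = ax² + bx + c`, `Δ > 0`, by "an ingenious device" (T. Ngo, *On roots of quadratic
congruences*, Bull. LMS 2024 = arXiv:2107.13301, §3.4): a **`T`-function** — a smooth, compactly
supported `p ≥ 0` on the line with `∑_{n ∈ ℤ} p(Tⁿx) = 1` for the hyperbolic generator `T` of the
automorph group (Ngo, Definition 3.10, Lemma 3.11) — whose pull-back `ψ_q(ξ) = p(c/d)` is a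
partition of unity on `Γ` over the right action of the automorph group `Γ^q` (Ngo, Proposition
3.12): `∑_{γ ∈ Γ^q} ψ_q(ξγ) = 1`.  Inserting `ψ_q` turns the sum over `Γ_∞∖Γ/Γ^q` (the `T`-classes of
forms of a class, i.e. the roots) into a full sum over `Γ_∞∖Γ` with smooth compactly supported
weights (Ngo, Corollary 3.13), ready for Poisson summation and Kloosterman sums.

This file constructs the device in the tree's conventions (forms acted on the right by `SL₂(ℤ)`,
`RootForms.smul`; the automorphs `stab R` act on the *first column* `ξe₁`, cf.
`QuadraticRootsLevelClasses.dcEquiv`), re-using the Cayley conjugation of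
`QuadraticRootsLevelDeck`: the transport factor `κ(R, ξ) = (a − cθ₊)/(a − cθ₋)` (`deckFactor R ξ`)
is the Cayley coordinate of the first column of `ξ`, it is multiplicative under the automorphs
(`deckFactor_stab_mul`: `κ(R, gξ) = κ(R, g) κ(R, ξ)` for `g ∈ stab R`), and for the deck generator
`g₁` (`0 < κ₁ = κ(R, g₁) < 1`) the function

  `tothWeight R g₁ m ξ = β(log|κ(R, ξ)| / log κ₁⁻¹ − m)`,  `β(s) = ζ(s) − ζ(s − 1)`

(`ζ = Real.smoothTransition`, so `β` is smooth, `0 ≤ β ≤ 1`, supported in `[0, 2]`, and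
`∑_n β(s − n) = 1` by telescoping — `unitPartition`) satisfies

* `tothWeight_neg`, `tothWeight_mul_T_zpow` — it is a function on `SL₂(ℤ)/⟨±T⟩`, i.e. of the
  primitive first column `±(α, γ)`;
* **`tsum_tothWeight_zpow_mul`** — `∑_{k ∈ ℤ} tothWeight R g₁ m (g₁^k ξ) = 1` whenever
  `(R·ξ).a ≠ 0` (Tóth's property `∑_{γ ∈ Γ^q} ψ = 1`, up to the sign `±1 ∈ stab R`);
* `tothWeight_ne_zero_iff`-type support control: `tothWeight ≠ 0` forces
  `κ₁^{-m} < |κ(R, ξ)| < κ₁^{-m-2}` (`abs_deckFactor_mem_of_tothWeight_ne_zero`), whence, together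
  with `A' = A(α − θ₊γ)(α − θ₋γ)`, first columns of size `≍ √A'` only (`rootFactor_sq_eq`).

Everything here is proved; nothing of Tóth's paper (cite-only in the store) is vendored.

## References

* Á. Tóth, *Roots of quadratic congruences*, IMRN 2000, no. 14, 719–739 (the partition of unity
  over the automorphs; cite-only, as described by Ngo). [cite: Toth2000, main theorem]
* T. Ngo, *On roots of quadratic congruences*, arXiv:2107.13301 (Bull. LMS 2024), §3.4:
  Definition 3.10 (`T`-function), Lemma 3.11 (existence), Proposition 3.12 (`ψ_q`), Corollary 3.13
  (unfolding). [cite: Ngo2024, §3.4, Definition 3.10–Proposition 3.12]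
-/

noncomputable section

namespace Literature.NumberTheory.Sieve

open scoped MatrixGroups
open Literature.NumberTheory.QuadraticFields.Quadratic (BinQF)
open ModularGroup (T)

namespace RootForms

/-! ### The unit partition of unity on `ℝ` -/

/-- `β(s) = ζ(s) − ζ(s − 1)`, `ζ` Mathlib's smooth transition (`0` on `s ≤ 0`, `1` on `s ≥ 1`):
a smooth bump supported in `[0, 2]` whose integer translates sum to `1`.
[cite: Ngo2024, §3.4 Lemma 3.11 (the function `p₀/∑ p₀∘Tⁿ`)] -/
def unitPartition (s : ℝ) : ℝ := Real.smoothTransition s - Real.smoothTransition (s - 1)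

/-- `β ≥ 0` (`ζ` is monotone). [folklore] -/
theorem unitPartition_nonneg (s : ℝ) : 0 ≤ unitPartition s :=
  sub_nonneg.2 (Real.smoothTransition.monotone (by linarith))

/-- `β ≤ 1`. [folklore] -/
theorem unitPartition_le_one (s : ℝ) : unitPartition s ≤ 1 := by
  have h1 := Real.smoothTransition.le_one s
  have h2 := Real.smoothTransition.nonneg (s - 1)
  unfold unitPartition; linarith

/-- `β(s) = 0` for `s ≤ 0`. [folklore] -/
theorem unitPartition_of_nonpos {s : ℝ} (hs : s ≤ 0) : unitPartition s = 0 := by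
  rw [unitPartition, Real.smoothTransition.zero_of_nonpos hs,
    Real.smoothTransition.zero_of_nonpos (by linarith), sub_zero]

/-- `β(s) = 0` for `s ≥ 2`. [folklore] -/
theorem unitPartition_of_two_le {s : ℝ} (hs : 2 ≤ s) : unitPartition s = 0 := by
  rw [unitPartition, Real.smoothTransition.one_of_one_le (by linarith),
    Real.smoothTransition.one_of_one_le (by linarith), sub_self]

/-- `β(s) ≠ 0 ⇒ 0 < s < 2`. [folklore] -/
theorem pos_lt_two_of_unitPartition_ne_zero {s : ℝ} (h : unitPartition s ≠ 0) : 0 < s ∧ s < 2 := by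
  constructor
  · by_contra h'; exact h (unitPartition_of_nonpos (not_lt.1 h'))
  · by_contra h'; exact h (unitPartition_of_two_le (not_lt.1 h'))

/-- `β` is smooth. [folklore] -/
theorem contDiff_unitPartition {n : ℕ∞} : ContDiff ℝ n unitPartition :=
  Real.smoothTransition.contDiff.sub (Real.smoothTransition.contDiff.comp (contDiff_id.sub contDiff_const))

/-- `β` is continuous. [folklore] -/
theorem continuous_unitPartition : Continuous unitPartition :=
  Real.smoothTransition.continuous.sub (Real.smoothTransition.continuous.comp (continuous_id.sub continuous_const))

/-- **Telescoping**: `β(u) + β(u + 1) = 1` for `0 ≤ u < 1`... more precisely for `u ∈ [0, 1]`: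
`β(u) = ζ(u)` and `β(u + 1) = 1 − ζ(u)`. [folklore] -/
theorem unitPartition_add_unitPartition_add_one {u : ℝ} (h0 : 0 ≤ u) (h1 : u ≤ 1) :
    unitPartition u + unitPartition (u + 1) = 1 := by
  rw [unitPartition, unitPartition, add_sub_cancel_right,
    Real.smoothTransition.zero_of_nonpos (show u - 1 ≤ 0 by linarith),
    Real.smoothTransition.one_of_one_le (show (1 : ℝ) ≤ u + 1 by linarith)]
  ring

/-- **`∑_{n ∈ ℤ} β(s − n) = 1`** (only `n = ⌊s⌋ − 1, ⌊s⌋` contribute). [cite: Ngo2024, §3.4 Lemma 3.11] -/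
theorem tsum_unitPartition_sub_int (s : ℝ) : ∑' n : ℤ, unitPartition (s - n) = 1 := by
  have hfl := Int.floor_le s
  have hlt := Int.lt_floor_add_one s
  have hne : (⌊s⌋ - 1 : ℤ) ≠ ⌊s⌋ := by omega
  rw [tsum_eq_sum (s := {⌊s⌋ - 1, ⌊s⌋})]
  · rw [Finset.sum_pair hne]
    have e1 : s - ((⌊s⌋ - 1 : ℤ) : ℝ) = (s - ⌊s⌋) + 1 := by push_cast; ring
    rw [e1, add_comm, unitPartition_add_unitPartition_add_one (by linarith) (by linarith)]
  · intro n hn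
    simp only [Finset.mem_insert, Finset.mem_singleton, not_or] at hn
    rcases lt_or_gt_of_ne hn.2 with h | h
    · -- `n < ⌊s⌋`, `n ≠ ⌊s⌋ - 1` ⇒ `n ≤ ⌊s⌋ - 2` ⇒ `s - n ≥ 2`
      apply unitPartition_of_two_le
      have : n ≤ ⌊s⌋ - 2 := by omega
      have : (n : ℝ) ≤ (⌊s⌋ : ℝ) - 2 := by exact_mod_cast this
      linarith
    · apply unitPartition_of_nonpos
      have : ⌊s⌋ + 1 ≤ n := by omega
      have : (⌊s⌋ : ℝ) + 1 ≤ (n : ℝ) := by exact_mod_cast this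
      linarith

/-! ### The transport factor of an arbitrary matrix and the automorphs -/

variable {R : BinQF}

/-- **`κ(R, gξ) = κ(R, g) κ(R, ξ)` for an automorph `g`**: the Cayley coordinate
`κ(R, ξ) = (α − γθ₊)/(α − γθ₋)` of the first column `(α, γ)` of `ξ` is multiplied by the deck
factor (the numerator factorises as `(a − cθ₊)(α − γθ₊)` because `g` fixes `θ₊`).
[cite: Ngo2024, §3.4 Proposition 3.12 (proof: `ψ_q(ξ) = p₁(c/d)`)] -/
theorem deckFactor_stab_mul (hA : R.a ≠ 0) (hΔ : 0 ≤ R.disc) {g : SL(2, ℤ)} (hg : g ∈ stab R)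
    (ξ : SL(2, ℤ)) : deckFactor R (g * ξ) = deckFactor R g * deckFactor R ξ := by
  have hA' : (smul R g).a ≠ 0 := by rw [mem_stab_iff.1 hg]; exact hA
  have hp := rootFactor_mul_rootPlus_smul hA hΔ g hA'
  have hm := rootFactor_mul_rootMinus_smul hA hΔ g hA'
  rw [mem_stab_iff.1 hg] at hp hm
  -- entries of `g ξ`
  have e00 : ((g * ξ : SL(2, ℤ)) 0 0 : ℤ) = g 0 0 * ξ 0 0 + g 0 1 * ξ 1 0 := by
    simp [Matrix.mul_apply, Fin.sum_univ_two]
  have e10 : ((g * ξ : SL(2, ℤ)) 1 0 : ℤ) = g 1 0 * ξ 0 0 + g 1 1 * ξ 1 0 := by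
    simp [Matrix.mul_apply, Fin.sum_univ_two]
  have fp : (((g * ξ : SL(2, ℤ)) 0 0 : ℤ) : ℝ) - ((g * ξ : SL(2, ℤ)) 1 0 : ℤ) * rootPlus R =
      (((g 0 0 : ℤ) : ℝ) - (g 1 0 : ℤ) * rootPlus R) * (((ξ 0 0 : ℤ) : ℝ) - (ξ 1 0 : ℤ) * rootPlus R) := by
    rw [e00, e10]; push_cast
    linear_combination ((ξ 1 0 : ℤ) : ℝ) * hp
  have fm : (((g * ξ : SL(2, ℤ)) 0 0 : ℤ) : ℝ) - ((g * ξ : SL(2, ℤ)) 1 0 : ℤ) * rootMinus R =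
      (((g 0 0 : ℤ) : ℝ) - (g 1 0 : ℤ) * rootMinus R) * (((ξ 0 0 : ℤ) : ℝ) - (ξ 1 0 : ℤ) * rootMinus R) := by
    rw [e00, e10]; push_cast
    linear_combination ((ξ 1 0 : ℤ) : ℝ) * hm
  rw [deckFactor, deckFactor, deckFactor, fp, fm, mul_div_mul_comm]

/-- `κ(R, ξT^j) = κ(R, ξ)` (same first column). [folklore] -/
theorem deckFactor_mul_T_zpow (R : BinQF) (ξ : SL(2, ℤ)) (j : ℤ) :
    deckFactor R (ξ * T ^ j) = deckFactor R ξ := by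
  have e00 : ((ξ * T ^ j : SL(2, ℤ)) 0 0 : ℤ) = ξ 0 0 := by
    have h := ModularGroup.coe_T_zpow j
    show (ξ.1 * (T ^ j).1) 0 0 = ξ.1 0 0
    rw [h]; simp [Matrix.mul_apply, Fin.sum_univ_two]
  have e10 : ((ξ * T ^ j : SL(2, ℤ)) 1 0 : ℤ) = ξ 1 0 := by
    have h := ModularGroup.coe_T_zpow j
    show (ξ.1 * (T ^ j).1) 1 0 = ξ.1 1 0
    rw [h]; simp [Matrix.mul_apply, Fin.sum_univ_two]
  rw [deckFactor, deckFactor, e00, e10]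

/-- `κ(R, g^k ξ) = κ(R, g)^k κ(R, ξ)` for `g ∈ stab R`. [folklore] -/
theorem deckFactor_zpow_mul (hA : R.a ≠ 0) (hΔ : 0 < R.disc) {g : SL(2, ℤ)} (hg : g ∈ stab R)
    (k : ℤ) (ξ : SL(2, ℤ)) : deckFactor R (g ^ k * ξ) = deckFactor R g ^ k * deckFactor R ξ := by
  rw [deckFactor_stab_mul hA hΔ.le (Subgroup.zpow_mem _ hg k), deckFactor_zpow hA hΔ hg]

/-- The two root factors of a first column: `(α − γθ₊)(α − γθ₋) = A'/A` with `A' = (R·ξ).a`, so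
`(α − γθ₊)² = (A'/A)·κ(R, ξ)` and `(α − γθ₋)² = (A'/A)/κ(R, ξ)` — first columns with `κ ≍ 1` and
`A' ≍ x` have entries `≪ √x`. [cite: Ngo2024, §3.4–3.5 (`c ≍ √x ≍ d` on the support of `ψ`)] -/
theorem rootFactor_plus_sq_eq (hA : R.a ≠ 0) (hΔ : 0 ≤ R.disc) (ξ : SL(2, ℤ))
    (hA' : (smul R ξ).a ≠ 0) :
    (((ξ 0 0 : ℤ) : ℝ) - (ξ 1 0 : ℤ) * rootPlus R) ^ 2 =
      ((smul R ξ).a : ℝ) / R.a * deckFactor R ξ := by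
  have h := smul_a_eq_mul_rootFactors hA hΔ ξ
  have hm := rootFactor_minus_ne_zero hA hΔ hA'
  have hAc : (R.a : ℝ) ≠ 0 := by exact_mod_cast hA
  rw [deckFactor, h]
  field_simp

/-- Companion: `(α − γθ₋)² = (A'/A)/κ(R, ξ)`. [folklore] -/
theorem rootFactor_minus_sq_eq (hA : R.a ≠ 0) (hΔ : 0 ≤ R.disc) (ξ : SL(2, ℤ))
    (hA' : (smul R ξ).a ≠ 0) :
    (((ξ 0 0 : ℤ) : ℝ) - (ξ 1 0 : ℤ) * rootMinus R) ^ 2 =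
      ((smul R ξ).a : ℝ) / R.a / deckFactor R ξ := by
  have h := smul_a_eq_mul_rootFactors hA hΔ ξ
  have hp := rootFactor_plus_ne_zero hA hΔ hA'
  have hm := rootFactor_minus_ne_zero hA hΔ hA'
  have hAc : (R.a : ℝ) ≠ 0 := by exact_mod_cast hA
  rw [deckFactor, h]
  field_simp

/-! ### Tóth's weight -/

/-- **Tóth's weight** attached to a base form `R`, an automorph `g₁` (`0 < κ(R, g₁) < 1`) and a
shift `m ∈ ℤ`: `ψ(ξ) = β(log|κ(R, ξ)| / log κ(R, g₁)⁻¹ − m)`, a function of the first column of `ξ`.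
[cite: Ngo2024, §3.4 Proposition 3.12 (`ψ_q(ξ) = p₁(c/d)`, `p₁` a `T₁`-function)] -/
def tothWeight (R : BinQF) (g₁ : SL(2, ℤ)) (m : ℤ) (ξ : SL(2, ℤ)) : ℝ :=
  unitPartition (Real.log |deckFactor R ξ| / Real.log (deckFactor R g₁)⁻¹ - m)

/-- `0 ≤ ψ ≤ 1`. [cite: Ngo2024, §3.4 Definition 3.10] -/
theorem tothWeight_nonneg (R : BinQF) (g₁ : SL(2, ℤ)) (m : ℤ) (ξ : SL(2, ℤ)) :
    0 ≤ tothWeight R g₁ m ξ := unitPartition_nonneg _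

/-- `0 ≤ ψ ≤ 1`. [cite: Ngo2024, §3.4 Definition 3.10] -/
theorem tothWeight_le_one (R : BinQF) (g₁ : SL(2, ℤ)) (m : ℤ) (ξ : SL(2, ℤ)) :
    tothWeight R g₁ m ξ ≤ 1 := unitPartition_le_one _

/-- `ψ(−ξ) = ψ(ξ)`. [folklore] -/
@[simp] theorem tothWeight_neg (R : BinQF) (g₁ : SL(2, ℤ)) (m : ℤ) (ξ : SL(2, ℤ)) :
    tothWeight R g₁ m (-ξ) = tothWeight R g₁ m ξ := by
  rw [tothWeight, tothWeight, deckFactor_neg]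

/-- `ψ(ξT^j) = ψ(ξ)`: `ψ` is a function on `SL₂(ℤ)/Γ_∞`. [cite: Ngo2024, §3.4 Proposition 3.12 (1)] -/
@[simp] theorem tothWeight_mul_T_zpow (R : BinQF) (g₁ : SL(2, ℤ)) (m : ℤ) (ξ : SL(2, ℤ)) (j : ℤ) :
    tothWeight R g₁ m (ξ * T ^ j) = tothWeight R g₁ m ξ := by
  rw [tothWeight, tothWeight, deckFactor_mul_T_zpow]

/-- The log-coordinate shifts by `−k` under `g₁^k`:
`log|κ(R, g₁^kξ)|/log κ₁⁻¹ = log|κ(R, ξ)|/log κ₁⁻¹ − k`. [folklore] -/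
theorem logCoord_zpow_mul (hA : R.a ≠ 0) (hΔ : 0 < R.disc) {g₁ : SL(2, ℤ)} (hg₁ : g₁ ∈ stab R)
    (hκ : deckFactor R g₁ < 1) (k : ℤ) {ξ : SL(2, ℤ)} (hξ : deckFactor R ξ ≠ 0) :
    Real.log |deckFactor R (g₁ ^ k * ξ)| / Real.log (deckFactor R g₁)⁻¹ =
      Real.log |deckFactor R ξ| / Real.log (deckFactor R g₁)⁻¹ - k := by
  have hκ0 := deckFactor_pos hA hΔ.le hg₁
  have hL : Real.log (deckFactor R g₁) ≠ 0 := Real.log_ne_zero_of_pos_of_ne_one hκ0 hκ.ne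
  rw [deckFactor_zpow_mul hA hΔ hg₁ k ξ, abs_mul, abs_of_pos (zpow_pos hκ0 k),
    Real.log_mul (zpow_ne_zero k hκ0.ne') (abs_ne_zero.2 hξ), Real.log_zpow, Real.log_inv]
  field_simp
  ring

/-- **Tóth's partition of unity**: `∑_{k ∈ ℤ} ψ(g₁^k ξ) = 1` for every `ξ` with `(R·ξ).a ≠ 0`
(together with `ψ(−ξ) = ψ(ξ)`: `∑_{γ ∈ stab R} ψ(γξ) = 2`, `stab R = {±g₁^k}`).
[cite: Ngo2024, §3.4 Proposition 3.12 (2)] -/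
theorem tsum_tothWeight_zpow_mul (hA : R.a ≠ 0) (hΔ : 0 < R.disc) {g₁ : SL(2, ℤ)}
    (hg₁ : g₁ ∈ stab R) (hκ : deckFactor R g₁ < 1) (m : ℤ) {ξ : SL(2, ℤ)}
    (hA' : (smul R ξ).a ≠ 0) :
    ∑' k : ℤ, tothWeight R g₁ m (g₁ ^ k * ξ) = 1 := by
  have hξ := deckFactor_ne_zero hA hΔ.le hA'
  have e : ∀ k : ℤ, tothWeight R g₁ m (g₁ ^ k * ξ) =
      unitPartition ((Real.log |deckFactor R ξ| / Real.log (deckFactor R g₁)⁻¹ - m) - k) := by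
    intro k
    rw [tothWeight, logCoord_zpow_mul hA hΔ hg₁ hκ k hξ]
    ring_nf
  simp_rw [e]
  exact tsum_unitPartition_sub_int _

/-- Only two consecutive exponents carry weight: `ψ(g₁^kξ) = 0` unless
`k ∈ {⌊s⌋ − 1, ⌊s⌋}`, `s = log|κ(R,ξ)|/log κ₁⁻¹ − m`. [folklore] -/
theorem tothWeight_zpow_mul_eq_zero (hA : R.a ≠ 0) (hΔ : 0 < R.disc) {g₁ : SL(2, ℤ)}
    (hg₁ : g₁ ∈ stab R) (hκ : deckFactor R g₁ < 1) (m : ℤ) {ξ : SL(2, ℤ)}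
    (hA' : (smul R ξ).a ≠ 0) {k : ℤ}
    (hk : k ≠ ⌊Real.log |deckFactor R ξ| / Real.log (deckFactor R g₁)⁻¹ - m⌋ - 1 ∧
      k ≠ ⌊Real.log |deckFactor R ξ| / Real.log (deckFactor R g₁)⁻¹ - m⌋) :
    tothWeight R g₁ m (g₁ ^ k * ξ) = 0 := by
  have hξ := deckFactor_ne_zero hA hΔ.le hA'
  set s := Real.log |deckFactor R ξ| / Real.log (deckFactor R g₁)⁻¹ - m with hs
  rw [tothWeight, logCoord_zpow_mul hA hΔ hg₁ hκ k hξ]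
  have e : Real.log |deckFactor R ξ| / Real.log (deckFactor R g₁)⁻¹ - k - m = s - k := by
    rw [hs]; ring
  rw [e]
  have hfl := Int.floor_le s
  have hlt := Int.lt_floor_add_one s
  rcases lt_or_gt_of_ne hk.2 with h | h
  · apply unitPartition_of_two_le
    have : k ≤ ⌊s⌋ - 2 := by omega
    have : (k : ℝ) ≤ (⌊s⌋ : ℝ) - 2 := by exact_mod_cast this
    linarith
  · apply unitPartition_of_nonpos
    have : ⌊s⌋ + 1 ≤ k := by omega
    have : (⌊s⌋ : ℝ) + 1 ≤ (k : ℝ) := by exact_mod_cast this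
    linarith

/-- **Support control**: `ψ(ξ) ≠ 0` forces `m < log|κ(R,ξ)|/log κ₁⁻¹ < m + 2`, i.e.
`κ₁^{-m} < |κ(R, ξ)| < κ₁^{-(m+2)}`. [cite: Ngo2024, §3.4 Proposition 3.12 (3)] -/
theorem abs_deckFactor_mem_of_tothWeight_ne_zero (hA : R.a ≠ 0) (hΔ : 0 < R.disc) {g₁ : SL(2, ℤ)}
    (hg₁ : g₁ ∈ stab R) (hκ : deckFactor R g₁ < 1) (m : ℤ) {ξ : SL(2, ℤ)}
    (hA' : (smul R ξ).a ≠ 0) (h : tothWeight R g₁ m ξ ≠ 0) :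
    (deckFactor R g₁)⁻¹ ^ m < |deckFactor R ξ| ∧ |deckFactor R ξ| < (deckFactor R g₁)⁻¹ ^ (m + 2) := by
  have hξ := deckFactor_ne_zero hA hΔ.le hA'
  have hκ0 := deckFactor_pos hA hΔ.le hg₁
  have hb : 1 < (deckFactor R g₁)⁻¹ := one_lt_inv₀ hκ0 |>.2 hκ
  have hL : 0 < Real.log (deckFactor R g₁)⁻¹ := Real.log_pos hb
  obtain ⟨h1, h2⟩ := pos_lt_two_of_unitPartition_ne_zero h
  have habs : 0 < |deckFactor R ξ| := abs_pos.2 hξ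
  constructor
  · -- `m < log|κ|/L` ⇒ `b^m < |κ|`
    have h3 : (m : ℝ) * Real.log (deckFactor R g₁)⁻¹ < Real.log |deckFactor R ξ| := by
      rw [← lt_div_iff₀ hL]; linarith
    rw [← Real.log_zpow] at h3
    exact (Real.log_lt_log_iff (zpow_pos (zero_lt_one.trans hb) m) habs).1 h3
  · have h3 : Real.log |deckFactor R ξ| < ((m + 2 : ℤ) : ℝ) * Real.log (deckFactor R g₁)⁻¹ := by
      rw [← div_lt_iff₀ hL]; push_cast; linarith
    rw [← Real.log_zpow] at h3
    exact (Real.log_lt_log_iff habs (zpow_pos (zero_lt_one.trans hb) _)).1 h3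

/-- `ψ` is continuous in the transport factor off `0` (for later smoothness bookkeeping the closed
form `β(log|·|/L − m)` is what matters). [folklore] -/
theorem tothWeight_eq (R : BinQF) (g₁ : SL(2, ℤ)) (m : ℤ) (ξ : SL(2, ℤ)) :
    tothWeight R g₁ m ξ =
      unitPartition (Real.log |deckFactor R ξ| / Real.log (deckFactor R g₁)⁻¹ - m) := rfl

end RootForms

end Literature.NumberTheory.Sieve

/-!
## Part 2. Tóth's unfolding: `T`-classes of a class of forms as a weighted sum over primitive vectors

Topic `Literature/NumberTheory/Sieve`, continuation of Part 1.  For an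
indefinite form `R` of non-square discriminant the `T`-classes of the forms `R·ξ` of its class —
which carry the roots of the quadratic congruences, `QuadraticRootsLevelForms/…/Classes` — are the
double cosets `stab R ∖ SL₂(ℤ) ∕ ⟨T⟩` (`…LevelClasses.dcEquiv`), and `SL₂(ℤ) ∕ ⟨T⟩` is the set of
primitive integer vectors (first columns).  Tóth's partition of unity `ψ = tothWeight R g₁ m`
(`∑_k ψ(g₁^k ξ) = 1`, `ψ(−ξ) = ψ(ξ)`, `ψ(ξT^j) = ψ(ξ)`) unfolds the quotient by the infinite group
`stab_{q₀}(R) = {±g₁^k}` (for any level `q₀`, working inside `Γ₀(q₀)`): for every `W : SL₂(ℤ) → ℂ`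
invariant under `stab_{q₀}(R)` on the left and `⟨T⟩` on the right and supported on finitely many
`T`-classes of the `Γ₀(q₀)`-orbit,

  `∑'_{v primitive, q₀ ∣ γ} W(ξ_v) ψ(ξ_v) = 2 ∑'_{Q ∈ T-classes of the orbit} W(ξ_Q)`
  (`tsum_primVec_mul_tothWeight`)

(`ξ_v` any matrix with first column `v`, `ξ_Q` any matrix with `R·ξ_Q = Q`; the factor `2` is the
sign `±1 ∈ stab R`).  This is Corollary 3.13 of T. Ngo, arXiv:2107.13301 (Bull. LMS 2024),
describing Á. Tóth's method (IMRN 2000), in the tree's first-column conventions; the right side is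
the sum over roots, the left side a sum over coprime pairs `(α, γ)` with smooth compactly
supported weights — the input of the Poisson/Kloosterman analysis.

* `RootForms.PrimVec q₀`, `PrimVec.toSL` (`…LevelCosets.colMatrix`), `PrimVec.ofSL`, the
  first-column bijection `Γ₀(q₀)∕⟨T⟩ ≅ PrimVec q₀` (`exists_eq_toSL_ofSL_mul_T_zpow`,
  `exists_T_zpow_of_ofSL_eq`);
* `RootForms.TRedOrbit R q₀` (the `T`-reduced forms of the `Γ₀(q₀)`-orbit of `R`, with chosen
  `ξ_Q ∈ Γ₀(q₀)`, `R·ξ_Q = Q`) and the bijection `(Bool × ℤ) × TRedOrbit R q₀ ≃ PrimVec q₀`,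
  `((ε, k), Q) ↦ ±g₁^k ξ_Q e₁` (`tothEquiv`), `g₁` generating `stab_{q₀}(R) = {±g₁^k}`
  (`…LevelDeck.exists_deck_generator`);
* the unfolding identity.  The natural level is `q₀ = a` (the leading coefficient of `f`: the forms
  `[A, B, C]` with `a ∣ A`, `B ≡ b (2a)` attached to the roots are `Γ₀(a)`-stable, Ngo §3.2), the
  further level `q = ad` of the Weyl sum being a divisibility condition inside `Γ₀(a)`.

Everything here is proved; nothing of Tóth's paper (cite-only in the store) is vendored.

## References

* Á. Tóth, *Roots of quadratic congruences*, IMRN 2000, no. 14, 719–739 (cite-only; the device as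
  described by Ngo). [cite: Toth2000, main theorem]
* T. Ngo, *On roots of quadratic congruences*, arXiv:2107.13301, §3.4 Proposition 3.12 and
  Corollary 3.13 (`P_j = ∑_{ξ ∈ Γ∞∖Γ'η} … ψ_j(ξ)`). [cite: Ngo2024, §3.4 Corollary 3.13]
-/

noncomputable section

namespace Literature.NumberTheory.Sieve

open scoped MatrixGroups
open Literature.NumberTheory.QuadraticFields.Quadratic (BinQF)
open ModularGroup (T)

namespace RootForms

/-! ### Primitive vectors and first columns -/

/-- Primitive integer vectors `(α, γ)`, `gcd(α, γ) = 1`, with `q₀ ∣ γ` — the first columns of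
`Γ₀(q₀)`, i.e. `Γ₀(q₀) ∕ ⟨T⟩` (`q₀ = 1`: all of `SL₂(ℤ) ∕ ⟨T⟩`). [folklore] -/
def PrimVec (q₀ : ℕ) : Type := {v : ℤ × ℤ // Int.gcd v.1 v.2 = 1 ∧ (q₀ : ℤ) ∣ v.2}

/-- Membership in `Γ₀(q₀)` is divisibility of the lower-left entry. [folklore] -/
theorem mem_Gamma0_iff_dvd {q₀ : ℕ} {ξ : SL(2, ℤ)} :
    ξ ∈ CongruenceSubgroup.Gamma0 q₀ ↔ (q₀ : ℤ) ∣ ξ 1 0 := by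
  rw [CongruenceSubgroup.Gamma0_mem, ZMod.intCast_zmod_eq_zero_iff_dvd]

namespace PrimVec

variable {q₀ : ℕ}

/-- `PrimVec q₀` is countable. [folklore] -/
instance : Countable (PrimVec q₀) := by unfold PrimVec; infer_instance

/-- A matrix of `Γ₀(q₀)` with first column `v`. [folklore] -/
def toSL (v : PrimVec q₀) : SL(2, ℤ) := colMatrix v.1.1 v.1.2 v.2.1

/-- First column of `toSL v`. [folklore] -/
@[simp] theorem toSL_apply_00 (v : PrimVec q₀) : v.toSL 0 0 = v.1.1 := rfl

/-- First column of `toSL v`. [folklore] -/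
@[simp] theorem toSL_apply_10 (v : PrimVec q₀) : v.toSL 1 0 = v.1.2 := rfl

/-- `toSL v ∈ Γ₀(q₀)`. [folklore] -/
theorem toSL_mem (v : PrimVec q₀) : v.toSL ∈ CongruenceSubgroup.Gamma0 q₀ :=
  mem_Gamma0_iff_dvd.2 v.2.2

/-- The first column of a matrix of `SL₂(ℤ)` is primitive. [folklore] -/
theorem gcd_col_eq_one (ξ : SL(2, ℤ)) : Int.gcd (ξ 0 0) (ξ 1 0) = 1 := by
  have hdet : ξ 0 0 * ξ 1 1 - ξ 0 1 * ξ 1 0 = 1 := by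
    have h := ξ.det_coe; rwa [Matrix.det_fin_two] at h
  have : IsCoprime (ξ 0 0) (ξ 1 0) := ⟨ξ 1 1, -(ξ 0 1), by linear_combination hdet⟩
  exact Int.isCoprime_iff_gcd_eq_one.1 this

/-- The first column of `ξ ∈ Γ₀(q₀)`. [folklore] -/
def ofSL (ξ : SL(2, ℤ)) (hξ : ξ ∈ CongruenceSubgroup.Gamma0 q₀) : PrimVec q₀ :=
  ⟨(ξ 0 0, ξ 1 0), gcd_col_eq_one ξ, mem_Gamma0_iff_dvd.1 hξ⟩

/-- Components of `ofSL`. [folklore] -/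
@[simp] theorem ofSL_val (ξ : SL(2, ℤ)) (hξ : ξ ∈ CongruenceSubgroup.Gamma0 q₀) :
    (ofSL ξ hξ).1 = (ξ 0 0, ξ 1 0) := rfl

/-- `ofSL (toSL v) = v`. [folklore] -/
@[simp] theorem ofSL_toSL (v : PrimVec q₀) : ofSL (toSL v) v.toSL_mem = v := by
  apply Subtype.ext; rfl

/-- Extensionality for `PrimVec`. [folklore] -/
theorem ext_iff' {v w : PrimVec q₀} : v = w ↔ v.1.1 = w.1.1 ∧ v.1.2 = w.1.2 := by
  constructor
  · rintro rfl; exact ⟨rfl, rfl⟩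
  · intro h; apply Subtype.ext; exact Prod.ext h.1 h.2

/-- `T ∈ Γ₀(q₀)`. [folklore] -/
theorem T_mem (q₀ : ℕ) : T ∈ CongruenceSubgroup.Gamma0 q₀ := by
  rw [CongruenceSubgroup.Gamma0_mem]; simp [ModularGroup.T]

/-- Right multiplication by `T^j` does not change the first column. [folklore] -/
theorem ofSL_mul_T_zpow (ξ : SL(2, ℤ)) (hξ : ξ ∈ CongruenceSubgroup.Gamma0 q₀) (j : ℤ)
    (h' : ξ * T ^ j ∈ CongruenceSubgroup.Gamma0 q₀) : ofSL (ξ * T ^ j) h' = ofSL ξ hξ := by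
  rw [ext_iff']
  have h := ModularGroup.coe_T_zpow j
  constructor
  · show (ξ.1 * (T ^ j).1) 0 0 = ξ.1 0 0
    rw [h]; simp [Matrix.mul_apply, Fin.sum_univ_two]
  · show (ξ.1 * (T ^ j).1) 1 0 = ξ.1 1 0
    rw [h]; simp [Matrix.mul_apply, Fin.sum_univ_two]

/-- `ofSL` only depends on the matrix (proof irrelevance helper). [folklore] -/
theorem ofSL_congr {ξ ξ' : SL(2, ℤ)} (e : ξ = ξ') (hξ : ξ ∈ CongruenceSubgroup.Gamma0 q₀)
    (hξ' : ξ' ∈ CongruenceSubgroup.Gamma0 q₀) : ofSL ξ hξ = ofSL ξ' hξ' := by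
  subst e; rfl

/-- **Same first column ⇒ same coset mod `⟨T⟩`**: `ofSL ξ = ofSL ξ'` forces `ξ' = ξ T^j`
(`ξ⁻¹ξ'` fixes `e₁`, so it is unipotent upper triangular). [folklore] -/
theorem exists_T_zpow_of_ofSL_eq {ξ ξ' : SL(2, ℤ)} {hξ : ξ ∈ CongruenceSubgroup.Gamma0 q₀}
    {hξ' : ξ' ∈ CongruenceSubgroup.Gamma0 q₀} (h : ofSL ξ hξ = ofSL ξ' hξ') :
    ∃ j : ℤ, ξ' = ξ * T ^ j := by
  rw [ext_iff'] at h
  simp only [ofSL_val] at h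
  obtain ⟨h0, h1⟩ := h
  have hdet : ξ 0 0 * ξ 1 1 - ξ 0 1 * ξ 1 0 = 1 := by
    have h := ξ.det_coe; rwa [Matrix.det_fin_two] at h
  have hdet' : ξ' 0 0 * ξ' 1 1 - ξ' 0 1 * ξ' 1 0 = 1 := by
    have h := ξ'.det_coe; rwa [Matrix.det_fin_two] at h
  -- `u = ξ⁻¹ ξ'` has lower-left entry `ξ₀₀ξ'₁₀ − ξ₁₀ξ'₀₀ = 0` and upper-left `1`
  set u := ξ⁻¹ * ξ' with hu
  have hu10 : u 1 0 = 0 := by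
    simp only [hu, Matrix.SpecialLinearGroup.coe_mul, Matrix.SpecialLinearGroup.coe_inv,
      Matrix.adjugate_fin_two, Matrix.mul_apply, Fin.sum_univ_two, Matrix.of_apply,
      Matrix.cons_val', Matrix.cons_val_zero, Matrix.cons_val_one, Matrix.empty_val',
      Matrix.cons_val_fin_one]
    rw [← h0, ← h1]; ring
  have hu00 : u 0 0 = 1 := by
    simp only [hu, Matrix.SpecialLinearGroup.coe_mul, Matrix.SpecialLinearGroup.coe_inv,
      Matrix.adjugate_fin_two, Matrix.mul_apply, Fin.sum_univ_two, Matrix.of_apply,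
      Matrix.cons_val', Matrix.cons_val_zero, Matrix.cons_val_one, Matrix.empty_val',
      Matrix.cons_val_fin_one]
    rw [← h0, ← h1]; linear_combination hdet
  have hudet : u 0 0 * u 1 1 - u 0 1 * u 1 0 = 1 := by
    have h := u.det_coe; rwa [Matrix.det_fin_two] at h
  rw [hu10, hu00, mul_zero, sub_zero, one_mul] at hudet
  refine ⟨u 0 1, ?_⟩
  have : ξ' = ξ * u := by rw [hu]; group
  rw [this]
  congr 1
  ext i j
  rw [ModularGroup.coe_T_zpow]
  fin_cases i <;> fin_cases j
  · simpa using hu00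
  · simp
  · simpa using hu10
  · simpa using hudet

/-- Every `ξ ∈ Γ₀(q₀)` is `toSL (ofSL ξ) T^j`. [folklore] -/
theorem exists_eq_toSL_ofSL_mul_T_zpow (ξ : SL(2, ℤ)) (hξ : ξ ∈ CongruenceSubgroup.Gamma0 q₀) :
    ∃ j : ℤ, ξ = toSL (ofSL ξ hξ) * T ^ j :=
  exists_T_zpow_of_ofSL_eq (hξ := (ofSL ξ hξ).toSL_mem) (hξ' := hξ) (by rw [ofSL_toSL])

end PrimVec

/-! ### The `T`-reduced forms of a `Γ₀(q₀)`-orbit and their representatives -/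

/-- The `T`-reduced forms of the `Γ₀(q₀)`-orbit of `R` (both signs of the first coefficient);
for `q₀ = 1` the `T`-reduced forms of the class of `R` (`…LevelClasses.ClassTRed`).
[cite: Toth2000, main theorem (cf. Ngo2024 §3.2: the orbit set `Γ∖𝒬_f`, `Γ = Γ₀(α)`)] -/
def TRedOrbit (R : BinQF) (q₀ : ℕ) : Type :=
  {Q : BinQF // IsTReduced Q ∧ ∃ γ : SL(2, ℤ), γ ∈ CongruenceSubgroup.Gamma0 q₀ ∧ smul R γ = Q}

namespace TRedOrbit

variable {R : BinQF} {q₀ : ℕ}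

/-- A chosen `ξ_Q ∈ Γ₀(q₀)` with `R·ξ_Q = Q`. [folklore] -/
def lift (Q : TRedOrbit R q₀) : SL(2, ℤ) := Classical.choose Q.2.2

/-- `ξ_Q ∈ Γ₀(q₀)`. [folklore] -/
theorem lift_mem (Q : TRedOrbit R q₀) : Q.lift ∈ CongruenceSubgroup.Gamma0 q₀ :=
  (Classical.choose_spec Q.2.2).1

/-- `R·ξ_Q = Q`. [folklore] -/
theorem smul_lift (Q : TRedOrbit R q₀) : smul R Q.lift = Q.1 :=
  (Classical.choose_spec Q.2.2).2

/-- `Q` is `T`-reduced. [folklore] -/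
theorem isTReduced (Q : TRedOrbit R q₀) : IsTReduced Q.1 := Q.2.1

/-- The `T`-reduced translate of `R·γ`, `γ ∈ Γ₀(q₀)`, as an element of the orbit. [folklore] -/
def ofElt (R : BinQF) (hR : ¬ IsSquare R.disc) {γ : SL(2, ℤ)}
    (hγ : γ ∈ CongruenceSubgroup.Gamma0 q₀) : TRedOrbit R q₀ :=
  ⟨tred (smul R γ), isTReduced_tred (a_ne_zero_of_not_isSquare (not_isSquare_smul_disc hR γ)),
    γ * T ^ tExp (smul R γ), by
      refine ⟨Subgroup.mul_mem _ hγ (Subgroup.zpow_mem _ (PrimVec.T_mem q₀) _), ?_⟩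
      rw [smul_mul]; rfl⟩

/-- The underlying form of `ofElt`. [folklore] -/
@[simp] theorem ofElt_val (hR : ¬ IsSquare R.disc) {γ : SL(2, ℤ)}
    (hγ : γ ∈ CongruenceSubgroup.Gamma0 q₀) : (ofElt R hR hγ).1 = tred (smul R γ) := rfl

end TRedOrbit

/-! ### `Γ₀(q)`-orbits and their representatives -/

section orbits

variable {q : ℕ}

/-- `Γ₀(q)`-equivalence of forms: `Q' = Q·γ` for some `γ ∈ Γ₀(q)`.
[cite: DukeFriedlanderIwaniec1995, §2 p. 428 (the `Γ₀(q)`-classes at level `q`)] -/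
def LevelEquiv (q : ℕ) (Q Q' : BinQF) : Prop :=
  ∃ γ : SL(2, ℤ), γ ∈ CongruenceSubgroup.Gamma0 q ∧ smul Q γ = Q'

/-- Reflexivity. [folklore] -/
theorem LevelEquiv.refl (Q : BinQF) : LevelEquiv q Q Q := ⟨1, Subgroup.one_mem _, smul_one Q⟩

/-- Symmetry. [folklore] -/
theorem LevelEquiv.symm {Q Q' : BinQF} (h : LevelEquiv q Q Q') : LevelEquiv q Q' Q := by
  obtain ⟨γ, hγ, hQ⟩ := h
  exact ⟨γ⁻¹, Subgroup.inv_mem _ hγ, by rw [← hQ, smul_mul_inv]⟩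

/-- Transitivity. [folklore] -/
theorem LevelEquiv.trans {Q Q' Q'' : BinQF} (h : LevelEquiv q Q Q') (h' : LevelEquiv q Q' Q'') :
    LevelEquiv q Q Q'' := by
  obtain ⟨γ, hγ, hQ⟩ := h
  obtain ⟨γ', hγ', hQ'⟩ := h'
  exact ⟨γ * γ', Subgroup.mul_mem _ hγ hγ', by rw [smul_mul, hQ, hQ']⟩

/-- A **canonical representative** of the `Γ₀(q)`-orbit of `Q` (a choice depending only on the
orbit). [folklore] -/
def orbitRep (q : ℕ) (Q : BinQF) : BinQF := Classical.epsilon (fun R => LevelEquiv q R Q)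

/-- The representative lies in the orbit. [folklore] -/
theorem levelEquiv_orbitRep (Q : BinQF) : LevelEquiv q (orbitRep q Q) Q :=
  Classical.epsilon_spec (p := fun R => LevelEquiv q R Q) ⟨Q, LevelEquiv.refl Q⟩

/-- Equivalent forms have the same representative. [folklore] -/
theorem orbitRep_eq_of_levelEquiv {Q Q' : BinQF} (h : LevelEquiv q Q Q') :
    orbitRep q Q = orbitRep q Q' := by
  unfold orbitRep
  congr 1
  funext R
  exact propext ⟨fun h1 => h1.trans h, fun h2 => h2.trans h.symm⟩

/-- The representative of a representative is itself. [folklore] -/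
theorem orbitRep_orbitRep (Q : BinQF) : orbitRep q (orbitRep q Q) = orbitRep q Q :=
  orbitRep_eq_of_levelEquiv (levelEquiv_orbitRep Q)

/-- `T`-translates are `Γ₀(q)`-equivalent. [folklore] -/
theorem levelEquiv_smul_T_zpow (Q : BinQF) (j : ℤ) : LevelEquiv q Q (smul Q (T ^ j)) :=
  ⟨T ^ j, Subgroup.zpow_mem _ (by rw [CongruenceSubgroup.Gamma0_mem]; simp [ModularGroup.T]) _,
    rfl⟩

/-- Equivalent forms have the same discriminant. [folklore] -/
theorem LevelEquiv.disc_eq {Q Q' : BinQF} (h : LevelEquiv q Q Q') : Q'.disc = Q.disc := by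
  obtain ⟨γ, _, rfl⟩ := h; exact smul_disc Q γ

end orbits

/-! ### The adapted parametrisation of the primitive vectors -/

section equiv

variable {q₀ : ℕ}

/-- A `T`-reduced form equal to a `T`-translate of a `T`-reduced form is that form. [folklore] -/
theorem isTReduced_T_zpow_unique {Q Q' : BinQF} (hA : Q.a ≠ 0) (hQ : IsTReduced Q)
    (hQ' : IsTReduced Q') {j : ℤ} (h : Q' = smul Q (T ^ j)) : j = 0 ∧ Q' = Q := by
  have hj : j = 0 := by
    have h0 : IsTReduced (smul Q (T ^ (0 : ℤ))) := by simpa using hQ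
    have h1 : IsTReduced (smul Q (T ^ j)) := h ▸ hQ'
    exact (existsUnique_isTReduced hA).unique h1 h0
  refine ⟨hj, ?_⟩
  rw [h, hj, zpow_zero, smul_one]

variable {R : BinQF} {g₁ : SL(2, ℤ)}

/-- The sign as a factor: `sgnSL true g = g`, `sgnSL false g = −g`. [folklore] -/
def sgnSL (ε : Bool) (g : SL(2, ℤ)) : SL(2, ℤ) := cond ε g (-g)

/-- `sgnSL true`. [folklore] -/
@[simp] theorem sgnSL_true (g : SL(2, ℤ)) : sgnSL true g = g := rfl

/-- `sgnSL false`. [folklore] -/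
@[simp] theorem sgnSL_false (g : SL(2, ℤ)) : sgnSL false g = -g := rfl

/-- `sgnSL ε g = s * g` with `s = ±1` central. [folklore] -/
theorem exists_sgnSL_eq (ε : Bool) : ∃ s : SL(2, ℤ), (s = 1 ∨ s = -1) ∧ ∀ g, sgnSL ε g = s * g := by
  cases ε
  · exact ⟨-1, Or.inr rfl, fun g => by simp⟩
  · exact ⟨1, Or.inl rfl, fun g => by simp⟩

/-- Forms do not see the sign. [folklore] -/
@[simp] theorem smul_sgnSL (Q : BinQF) (ε : Bool) (g : SL(2, ℤ)) : smul Q (sgnSL ε g) = smul Q g := by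
  cases ε <;> simp

/-- Tóth's weight does not see the sign. [folklore] -/
@[simp] theorem tothWeight_sgnSL (R : BinQF) (g₁ : SL(2, ℤ)) (m : ℤ) (ε : Bool) (g : SL(2, ℤ)) :
    tothWeight R g₁ m (sgnSL ε g) = tothWeight R g₁ m g := by
  cases ε <;> simp

/-- `sgnSL ε g * h = sgnSL ε (g * h)`. [folklore] -/
theorem sgnSL_mul (ε : Bool) (g h : SL(2, ℤ)) : sgnSL ε g * h = sgnSL ε (g * h) := by
  cases ε <;> simp

/-- The sign is determined by `sgnSL ε 1 = ±1`. [folklore] -/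
theorem sgnSL_one_inj {ε ε' : Bool} (h : sgnSL ε 1 = sgnSL ε' 1) : ε = ε' := by
  have hne : (1 : SL(2, ℤ)) ≠ -1 := fun h0 => by
    have := congrArg (fun g : SL(2, ℤ) => g 0 0) h0; simp at this
  cases ε <;> cases ε' <;> simp only [sgnSL_true, sgnSL_false] at h
  · rfl
  · exact absurd h.symm hne
  · exact absurd h hne
  · rfl

/-- `−g ∈ Γ₀(q₀)` for `g ∈ Γ₀(q₀)`. [folklore] -/
theorem neg_mem_Gamma0 {g : SL(2, ℤ)} (hg : g ∈ CongruenceSubgroup.Gamma0 q₀) :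
    -g ∈ CongruenceSubgroup.Gamma0 q₀ := by
  rw [mem_Gamma0_iff_dvd] at hg ⊢
  simpa using hg

/-- `sgnSL ε g ∈ Γ₀(q₀)` for `g ∈ Γ₀(q₀)`. [folklore] -/
theorem sgnSL_mem (ε : Bool) {g : SL(2, ℤ)} (hg : g ∈ CongruenceSubgroup.Gamma0 q₀) :
    sgnSL ε g ∈ CongruenceSubgroup.Gamma0 q₀ := by
  cases ε
  · exact neg_mem_Gamma0 hg
  · exact hg

/-- `±g₁^kξ_Q ∈ Γ₀(q₀)`. [folklore] -/
theorem tothElt_mem (hg₁ : g₁ ∈ CongruenceSubgroup.Gamma0 q₀) (x : (Bool × ℤ) × TRedOrbit R q₀) :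
    sgnSL x.1.1 (g₁ ^ x.1.2 * x.2.lift) ∈ CongruenceSubgroup.Gamma0 q₀ :=
  sgnSL_mem _ (Subgroup.mul_mem _ (Subgroup.zpow_mem _ hg₁ _) x.2.lift_mem)

/-- The adapted map `((ε, k), Q) ↦` first column of `±g₁^k ξ_Q`.
[cite: Ngo2024, §3.4 Corollary 3.13 (unfolding `Γ_∞∖Γ/Γ^q` by `ψ_q`)] -/
def tothMap (hg₁ : g₁ ∈ CongruenceSubgroup.Gamma0 q₀) (x : (Bool × ℤ) × TRedOrbit R q₀) :
    PrimVec q₀ :=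
  PrimVec.ofSL (sgnSL x.1.1 (g₁ ^ x.1.2 * x.2.lift)) (tothElt_mem hg₁ x)

/-- **Injectivity** (`A ≠ 0`, non-square `Δ > 0`, `g₁ ∈ stab_{q₀}(R)`, `κ(g₁) < 1`). [folklore] -/
theorem tothMap_injective (hA : R.a ≠ 0) (hΔ : 0 < R.disc) (hsq : ¬ IsSquare R.disc)
    (hg₁ : g₁ ∈ stabLevel R q₀) (hκ : deckFactor R g₁ < 1) :
    Function.Injective (tothMap (R := R) hg₁.2) := by
  have hg₁s : g₁ ∈ stab R := hg₁.1
  rintro ⟨⟨ε, k⟩, Q⟩ ⟨⟨ε', k'⟩, Q'⟩ h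
  obtain ⟨j, hj⟩ := PrimVec.exists_T_zpow_of_ofSL_eq h
  -- apply `R·`: `Q' = Q·T^j`
  have hQQ : Q'.1 = smul Q.1 (T ^ j) := by
    have := congrArg (smul R) hj
    simp only [smul_sgnSL, smul_mul, mem_stab_iff.1 (Subgroup.zpow_mem _ hg₁s k),
      mem_stab_iff.1 (Subgroup.zpow_mem _ hg₁s k'), TRedOrbit.smul_lift] at this
    exact this
  have hAQ : Q.1.a ≠ 0 := by
    rw [← Q.smul_lift]; exact a_ne_zero_of_not_isSquare (not_isSquare_smul_disc hsq _)
  obtain ⟨hj0, hQeq⟩ := isTReduced_T_zpow_unique hAQ Q.isTReduced Q'.isTReduced hQQ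
  have hQQ' : Q = Q' := (Subtype.ext hQeq).symm
  subst hQQ'
  rw [hj0, zpow_zero, mul_one] at hj
  -- `± g₁^{k'} ξ = ± g₁^k ξ`
  obtain ⟨s, hs, hsε⟩ := exists_sgnSL_eq ε
  obtain ⟨s', hs', hsε'⟩ := exists_sgnSL_eq ε'
  rw [hsε, hsε'] at hj
  have h2 : s' * g₁ ^ k' = s * g₁ ^ k := by
    have := congrArg (fun g : SL(2, ℤ) => g * (TRedOrbit.lift Q)⁻¹) hj
    simpa [mul_assoc] using this
  -- compare deck factors: `κ(s' g₁^{k'}) = κ₁^{k'}`, `κ(s g₁^k) = κ₁^k`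
  have hdeck : ∀ (t : SL(2, ℤ)), (t = 1 ∨ t = -1) → ∀ n : ℤ, deckFactor R (t * g₁ ^ n) = deckFactor R g₁ ^ n := by
    intro t ht n
    rcases ht with rfl | rfl
    · rw [one_mul, deckFactor_zpow hA hΔ hg₁s]
    · rw [neg_one_mul, deckFactor_neg, deckFactor_zpow hA hΔ hg₁s]
  have hkk : k' = k := by
    have e1 := congrArg (deckFactor R) h2
    rw [hdeck s' hs', hdeck s hs] at e1
    exact zpow_right_injective₀ (deckFactor_pos hA hΔ.le hg₁s) hκ.ne e1
  subst hkk
  have hss : s' = s := mul_right_cancel h2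
  have hεε : ε' = ε := sgnSL_one_inj (by rw [hsε' 1, hsε 1, mul_one, mul_one, hss])
  subst hεε
  rfl

/-- **Surjectivity** (`stab_{q₀}(R) = {±g₁^k}`): the first column of any `ξ ∈ Γ₀(q₀)` is that of
`±g₁^kξ_Q` with `Q = tred(R·ξ)`. [folklore] -/
theorem tothMap_surjective (hsq : ¬ IsSquare R.disc) (hg₁ : g₁ ∈ stabLevel R q₀)
    (hgen : ∀ g ∈ stabLevel R q₀, ∃ k : ℤ, g = g₁ ^ k ∨ g = -g₁ ^ k) :
    Function.Surjective (tothMap (R := R) hg₁.2) := by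
  intro v
  set ξ := v.toSL with hξ
  set Q : TRedOrbit R q₀ := TRedOrbit.ofElt R hsq v.toSL_mem with hQ
  set e : ℤ := tExp (smul R ξ) with he
  have h1 : smul R (ξ * T ^ e) = Q.1 := by rw [smul_mul]; rfl
  have hstab : ξ * T ^ e * Q.lift⁻¹ ∈ stab R :=
    smul_eq_smul_iff.1 (Q.smul_lift.trans h1.symm)
  have hlev : ξ * T ^ e * Q.lift⁻¹ ∈ stabLevel R q₀ :=
    ⟨hstab, Subgroup.mul_mem _ (Subgroup.mul_mem _ v.toSL_mem
      (Subgroup.zpow_mem _ (PrimVec.T_mem q₀) _)) (Subgroup.inv_mem _ Q.lift_mem)⟩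
  obtain ⟨k, hk⟩ := hgen _ hlev
  have key : ∀ ε : Bool, ξ * T ^ e * Q.lift⁻¹ = sgnSL ε (g₁ ^ k) →
      tothMap hg₁.2 ((ε, k), Q) = v := by
    intro ε hε
    have h2 : sgnSL ε (g₁ ^ k * Q.lift) = ξ * T ^ e := by
      rw [← sgnSL_mul, ← hε, inv_mul_cancel_right]
    have hmem : ξ * T ^ e ∈ CongruenceSubgroup.Gamma0 q₀ :=
      Subgroup.mul_mem _ v.toSL_mem (Subgroup.zpow_mem _ (PrimVec.T_mem q₀) _)
    show PrimVec.ofSL (sgnSL ε (g₁ ^ k * Q.lift)) _ = v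
    rw [PrimVec.ofSL_congr h2 _ hmem, PrimVec.ofSL_mul_T_zpow ξ v.toSL_mem]
    exact PrimVec.ofSL_toSL v
  rcases hk with h | h
  · exact ⟨((true, k), Q), key true (by simpa using h)⟩
  · exact ⟨((false, k), Q), key false (by simpa using h)⟩

/-- **`(Bool × ℤ) × TRedOrbit R q₀ ≃ PrimVec q₀`**, the parametrisation of `Γ₀(q₀)∕⟨T⟩` adapted
to the automorphs of `R`. [cite: Ngo2024, §3.4 Corollary 3.13] -/
def tothEquiv (hA : R.a ≠ 0) (hΔ : 0 < R.disc) (hsq : ¬ IsSquare R.disc)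
    (hg₁ : g₁ ∈ stabLevel R q₀) (hκ : deckFactor R g₁ < 1)
    (hgen : ∀ g ∈ stabLevel R q₀, ∃ k : ℤ, g = g₁ ^ k ∨ g = -g₁ ^ k) :
    (Bool × ℤ) × TRedOrbit R q₀ ≃ PrimVec q₀ :=
  Equiv.ofBijective _ ⟨tothMap_injective hA hΔ hsq hg₁ hκ, tothMap_surjective hsq hg₁ hgen⟩

end equiv

/-! ### The unfolding identity -/

section unfold

variable {R : BinQF} {g₁ : SL(2, ℤ)} {q₀ : ℕ}

/-- `−1 ∈ stab_{q₀}(R)`. [folklore] -/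
theorem neg_one_mem_stabLevel (R : BinQF) (q₀ : ℕ) : -1 ∈ stabLevel R q₀ :=
  ⟨neg_one_mem_stab R, neg_mem_Gamma0 (Subgroup.one_mem _)⟩

/-- A weight invariant under `stab_{q₀}(R)` on the left takes the value `W(ξ_Q)` on
`±g₁^kξ_Q`. [folklore] -/
theorem weight_sgnSL_zpow_mul (hg₁ : g₁ ∈ stabLevel R q₀) {W : SL(2, ℤ) → ℂ}
    (hWl : ∀ g ∈ stabLevel R q₀, ∀ ξ, W (g * ξ) = W ξ) (ε : Bool) (k : ℤ) (ξ : SL(2, ℤ)) :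
    W (sgnSL ε (g₁ ^ k * ξ)) = W ξ := by
  obtain ⟨s, hs, hsε⟩ := exists_sgnSL_eq ε
  have hsmem : s ∈ stabLevel R q₀ := by
    rcases hs with rfl | rfl
    · exact Subgroup.one_mem _
    · exact neg_one_mem_stabLevel R q₀
  rw [hsε, ← mul_assoc, hWl _ (Subgroup.mul_mem _ hsmem (Subgroup.zpow_mem _ hg₁ k))]

/-- **Tóth's unfolding** (Ngo, Corollary 3.13, in first-column conventions).  Let `R` have
`A ≠ 0` and non-square `Δ > 0`, let `g₁` generate `stab_{q₀}(R) = {±g₁^k}` with `κ(R, g₁) < 1`,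
and let `W : SL₂(ℤ) → ℂ` be invariant under `stab_{q₀}(R)` on the left and `⟨T⟩` on the right,
non-zero on only finitely many `T`-classes of the `Γ₀(q₀)`-orbit.  Then for every shift `m`,

  `∑'_{v primitive, q₀ ∣ γ} W(ξ_v) ψ(ξ_v) = 2 ∑'_{Q : T-classes of the orbit of R} W(ξ_Q)`,

`ψ = tothWeight R g₁ m`: the sum over the roots (the `T`-classes) is a sum over all coprime pairs
`(α, γ)` weighted by the smooth compactly supported partition of unity.
[cite: Ngo2024, §3.4 Corollary 3.13; Toth2000, main theorem] -/
theorem tsum_primVec_mul_tothWeight (hA : R.a ≠ 0) (hΔ : 0 < R.disc) (hsq : ¬ IsSquare R.disc)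
    (hg₁ : g₁ ∈ stabLevel R q₀) (hκ : deckFactor R g₁ < 1)
    (hgen : ∀ g ∈ stabLevel R q₀, ∃ k : ℤ, g = g₁ ^ k ∨ g = -g₁ ^ k) (m : ℤ)
    {W : SL(2, ℤ) → ℂ} (hWl : ∀ g ∈ stabLevel R q₀, ∀ ξ, W (g * ξ) = W ξ)
    (hWr : ∀ (ξ : SL(2, ℤ)) (j : ℤ), W (ξ * T ^ j) = W ξ)
    (hfin : (Function.support fun Q : TRedOrbit R q₀ => W Q.lift).Finite) :
    ∑' v : PrimVec q₀, W v.toSL * (tothWeight R g₁ m v.toSL : ℂ) =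
      2 * ∑' Q : TRedOrbit R q₀, W Q.lift := by
  classical
  have hg₁s : g₁ ∈ stab R := hg₁.1
  set e := tothEquiv hA hΔ hsq hg₁ hκ hgen with he
  -- pull back along the adapted parametrisation
  rw [← Equiv.tsum_eq e]
  have hterm : ∀ x : (Bool × ℤ) × TRedOrbit R q₀,
      W (e x).toSL * (tothWeight R g₁ m (e x).toSL : ℂ) =
        W x.2.lift * (tothWeight R g₁ m (g₁ ^ x.1.2 * x.2.lift) : ℂ) := by
    rintro ⟨⟨ε, k⟩, Q⟩
    -- `(e x).toSL = ± g₁^k ξ_Q · T^j`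
    have hmem := tothElt_mem (R := R) hg₁.2 ((ε, k), Q)
    obtain ⟨j, hj⟩ := PrimVec.exists_eq_toSL_ofSL_mul_T_zpow (sgnSL ε (g₁ ^ k * Q.lift)) hmem
    have h1 : (e ((ε, k), Q)).toSL = sgnSL ε (g₁ ^ k * Q.lift) * T ^ (-j) := by
      show (PrimVec.ofSL (sgnSL ε (g₁ ^ k * Q.lift)) hmem).toSL = _
      rw [zpow_neg, eq_mul_inv_iff_mul_eq]
      exact hj.symm
    rw [h1, hWr, tothWeight_mul_T_zpow, tothWeight_sgnSL, weight_sgnSL_zpow_mul hg₁ hWl]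
  simp_rw [hterm]
  -- finite support: the `Q` with `W(ξ_Q) ≠ 0`, and for each two exponents
  set Qs : Finset (TRedOrbit R q₀) := hfin.toFinset with hQs
  set kOf : TRedOrbit R q₀ → ℤ := fun Q =>
    ⌊Real.log |deckFactor R Q.lift| / Real.log (deckFactor R g₁)⁻¹ - m⌋ with hkOf
  set Ks : Finset ℤ := Qs.biUnion (fun Q => {kOf Q - 1, kOf Q}) with hKs
  have hAQ : ∀ Q : TRedOrbit R q₀, (smul R Q.lift).a ≠ 0 := fun Q => by
    rw [Q.smul_lift]; rw [← Q.smul_lift]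
    exact a_ne_zero_of_not_isSquare (not_isSquare_smul_disc hsq _)
  have hvanish : ∀ (Q : TRedOrbit R q₀) (k : ℤ), k ≠ kOf Q - 1 ∧ k ≠ kOf Q →
      tothWeight R g₁ m (g₁ ^ k * Q.lift) = 0 := fun Q k hk =>
    tothWeight_zpow_mul_eq_zero hA hΔ hg₁s hκ m (hAQ Q) hk
  rw [tsum_eq_sum (s := ((Finset.univ : Finset Bool) ×ˢ Ks) ×ˢ Qs)]
  · rw [Finset.sum_product, Finset.sum_product]
    simp only [Finset.sum_const, Finset.card_univ, Fintype.card_bool, nsmul_eq_mul, Nat.cast_ofNat]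
    congr 1
    -- `∑_{k ∈ Ks} ∑_{Q ∈ Qs} W ψ = ∑_{Q ∈ Qs} W · (∑_k ψ) = ∑_{Q ∈ Qs} W = ∑' Q, W`
    rw [Finset.sum_comm]
    rw [tsum_eq_sum (s := Qs)]
    · refine Finset.sum_congr rfl fun Q hQ => ?_
      rw [← Finset.mul_sum]
      have hk1 : ∑ k ∈ Ks, (tothWeight R g₁ m (g₁ ^ k * Q.lift) : ℂ) =
          ∑' k : ℤ, (tothWeight R g₁ m (g₁ ^ k * Q.lift) : ℂ) := by
        symm
        apply tsum_eq_sum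
        intro k hk
        have : k ≠ kOf Q - 1 ∧ k ≠ kOf Q := by
          constructor <;> intro h <;> apply hk <;> rw [hKs, Finset.mem_biUnion] <;>
            exact ⟨Q, hQ, by simp [h]⟩
        rw [hvanish Q k this, Complex.ofReal_zero]
      rw [hk1, ← Complex.ofReal_tsum, tsum_tothWeight_zpow_mul hA hΔ hg₁s hκ m (hAQ Q),
        Complex.ofReal_one, mul_one]
    · intro Q hQ
      rw [hQs, Set.Finite.mem_toFinset, Function.mem_support, not_not] at hQ
      exact hQ
  · rintro ⟨⟨ε, k⟩, Q⟩ hx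
    simp only [Finset.mem_product, Finset.mem_univ, true_and, not_and_or] at hx
    rcases hx with hk | hQ
    · by_cases hQ : Q ∈ Qs
      · have : k ≠ kOf Q - 1 ∧ k ≠ kOf Q := by
          constructor <;> intro h <;> apply hk <;> rw [hKs, Finset.mem_biUnion] <;>
            exact ⟨Q, hQ, by simp [h]⟩
        simp only
        rw [hvanish Q k this, Complex.ofReal_zero, mul_zero]
      · rw [hQs, Set.Finite.mem_toFinset, Function.mem_support, not_not] at hQ
        simp only
        rw [hQ, zero_mul]
    · rw [hQs, Set.Finite.mem_toFinset, Function.mem_support, not_not] at hQ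
      simp only
      rw [hQ, zero_mul]

end unfold

end RootForms

end Literature.NumberTheory.Sieve

/-!
## Part 3. The Weyl sums for roots of `ax² + bx + c` (`Δ > 0`) as Tóth-weighted sums over coprime pairs

Topic `Literature/NumberTheory/Sieve`, continuation of Part 2; the
pre-Poisson form of Á. Tóth's method (IMRN 2000) as presented by T. Ngo, arXiv:2107.13301, §3.2–3.4
(Lemma 3.3, Corollary 3.13, Lemma 3.2), in the tree's first-column conventions.  For
`f = ax² + bx + c` with `a > 0` and non-square `Δ = b² − 4ac > 0`, a weight `G` on the moduli and a
frequency `h`, the smoothed Weyl linear form at level `d`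

  `∑_{n ≤ N, d ∣ n} G(n) ∑_{f(ν) ≡ 0 (n)} e(hν/n)`

is (`…LevelForms.sum_weylSum_eq_sum_levelForms`) a sum over the `T`-reduced forms `Q = [A, B, C]`
with `ad ∣ A`, `0 < A ≤ aN`, `B ≡ b (2a)`, disc `Δ`, of `G(A/a) e(h(B − b)/2A)`.  These forms are
`Γ₀(a)`-stable; grouping them by `Γ₀(a)`-orbits (`orbitRep a`) and unfolding each orbit by Tóth's
partition of unity (`tsum_primVec_mul_tothWeight`, level `q₀ = a`) gives
**`weylSum_eq_sum_tothSum`**: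

  `∑_{n ≤ N, d ∣ n} G(n) S_f(h, n) = ∑_{R} ½ ∑'_{(α, γ) coprime, a ∣ γ} W_R(ξ_{(α,γ)}) ψ_R(ξ_{(α,γ)})`,

`R` over representatives of the `Γ₀(a)`-orbits met (their number is bounded in terms of `f` only),
`W_R(ξ) = [ad ∣ A', 0 < A' ≤ aN] G(A'/a) e(h(B' − b)/2A')` for `R·ξ = [A', B', C']`
(`weylWeightSL`), `ψ_R` Tóth's weight for a deck generator of `stab_a(R)`.  **Hooley's identity**
(`hooley_identity`: `B'α − 2A'β = Bα + 2Cγ` for `ξ = (α β; γ δ)`, Ngo Lemma 3.2) factors the phase as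
`e(hβ/α) ·` (a smooth function of `(α, γ)`), `β ≡ −γ⁻¹ (mod α)` (`weylPhase_factor`,
`col_mul_gcdB_modEq`): the inner sums are sums of `e(−hγ̄/α)` against smooth compactly supported
weights in `(α, γ)` — the input of Poisson summation and Kloosterman sums (Ngo §3.5).  With the
shift `tothShift` the weight vanishes on the two vectors with `α = 0` (`tothWeight_eq_zero_of_col`).

Everything here is proved; nothing of Tóth's paper (cite-only in the store) is vendored.

## References

* Á. Tóth, *Roots of quadratic congruences*, IMRN 2000, no. 14, 719–739 (cite-only; as described
  by Ngo). [cite: Toth2000, main theorem]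
* T. Ngo, *On roots of quadratic congruences*, arXiv:2107.13301, §3.2 Lemma 3.2 (Hooley's
  identity), Lemma 3.3, §3.4 Corollary 3.13–3.14. [cite: Ngo2024, §3.2–3.4]
* C. Hooley, *On the number of divisors of quadratic polynomials*, Acta Math. 110 (1963) (the
  identity, as attributed by Ngo). [cite: Ngo2024, §3.2 Lemma 3.2]
-/

noncomputable section

namespace Literature.NumberTheory.Sieve

open scoped MatrixGroups
open Literature.NumberTheory.QuadraticFields.Quadratic (BinQF)
open ModularGroup (T)
open Polynomial

namespace RootForms

/-! ### The additive character `e(x)` -/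

/-- `e(x) = exp(2πix)`. [folklore] -/
def ex (x : ℝ) : ℂ := Complex.exp (2 * Real.pi * Complex.I * x)

/-- `e(x + y) = e(x) e(y)`. [folklore] -/
theorem ex_add (x y : ℝ) : ex (x + y) = ex x * ex y := by
  rw [ex, ex, ex, ← Complex.exp_add]; push_cast; ring_nf

/-- `e(n) = 1` for `n ∈ ℤ`. [folklore] -/
theorem ex_int (n : ℤ) : ex n = 1 := by
  rw [ex]
  have := Complex.exp_int_mul_two_pi_mul_I n
  rw [← this]; congr 1; push_cast; ring

/-- `e(x + n) = e(x)`. [folklore] -/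
theorem ex_add_int (x : ℝ) (n : ℤ) : ex (x + n) = ex x := by
  rw [ex_add, ex_int, mul_one]

/-- `|e(x)| = 1`. [folklore] -/
theorem norm_ex (x : ℝ) : ‖ex x‖ = 1 := by
  rw [ex]
  have : (2 * Real.pi * Complex.I * x : ℂ) = ((2 * Real.pi * x : ℝ) : ℂ) * Complex.I := by
    push_cast; ring
  rw [this, Complex.norm_exp_ofReal_mul_I]

/-- The phase of `…LevelForms.sum_weylSum_eq_sum_levelForms` in terms of `e`. [folklore] -/
theorem exp_phase_eq_ex (h b : ℤ) (Q : BinQF) :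
    Complex.exp (2 * Real.pi * Complex.I * ((h : ℂ) * ((Q.b : ℂ) - b) / (2 * (Q.a : ℂ)))) =
      ex (h * ((Q.b : ℝ) - b) / (2 * Q.a)) := by
  rw [ex]; push_cast; ring_nf

/-! ### Hooley's identity -/

variable {R : BinQF}

/-- **Hooley's identity** (polynomial form): for `ξ = (α β; γ δ) ∈ SL₂(ℤ)` and `R·ξ = [A', B', C']`,
`B'α − 2A'β = Bα + 2Cγ` (uses only `αδ − βγ = 1`).
[cite: Ngo2024, §3.2 Lemma 3.2 (`r(ξ)/v(ξ) = 2a/c − (rc + 2vd)/(c v(ξ))`)] -/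
theorem hooley_identity (R : BinQF) (ξ : SL(2, ℤ)) :
    (smul R ξ).b * ξ 0 0 - 2 * (smul R ξ).a * ξ 0 1 = R.b * ξ 0 0 + 2 * R.c * ξ 1 0 := by
  have hdet : ξ 0 0 * ξ 1 1 - ξ 0 1 * ξ 1 0 = 1 := by
    have h := ξ.det_coe; rwa [Matrix.det_fin_two] at h
  rw [smul_b, smul_a, BinQF.eval]
  linear_combination (R.b * ξ 0 0 + 2 * R.c * ξ 1 0) * hdet

/-- Hooley's identity over `ℝ`, divided form: `B'/(2A') = β/α + (Bα + 2Cγ)/(2αA')` (`α, A' ≠ 0`).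
[cite: Ngo2024, §3.2 Lemma 3.2] -/
theorem hooley_div (R : BinQF) (ξ : SL(2, ℤ)) (hα : ξ 0 0 ≠ 0) (hA' : (smul R ξ).a ≠ 0) :
    ((smul R ξ).b : ℝ) / (2 * (smul R ξ).a) =
      (ξ 0 1 : ℝ) / (ξ 0 0) + ((R.b : ℝ) * ξ 0 0 + 2 * R.c * ξ 1 0) / (2 * (ξ 0 0 : ℝ) * (smul R ξ).a) := by
  have h := hooley_identity R ξ
  have hc : (((smul R ξ).b * ξ 0 0 - 2 * (smul R ξ).a * ξ 0 1 : ℤ) : ℝ) =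
      ((R.b * ξ 0 0 + 2 * R.c * ξ 1 0 : ℤ) : ℝ) := by rw [h]
  push_cast at hc
  have hαr : ((ξ 0 0 : ℤ) : ℝ) ≠ 0 := by exact_mod_cast hα
  have hAr : (((smul R ξ).a : ℤ) : ℝ) ≠ 0 := by exact_mod_cast hA'
  field_simp
  linear_combination hc

/-- **Phase factorisation**: `e(h(B' − b)/2A') = e(hβ/α) · e(h(Bα + 2Cγ)/(2αA') − hb/2A')`.
The first factor is the Kloosterman phase (`β ≡ −γ⁻¹ (mod α)`), the second is a smooth function
of `(α, γ)` on the support of the weights. [cite: Ngo2024, §3.4 Corollary 3.14 (proof)] -/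
theorem weylPhase_factor (R : BinQF) (ξ : SL(2, ℤ)) (h b : ℤ) (hα : ξ 0 0 ≠ 0)
    (hA' : (smul R ξ).a ≠ 0) :
    ex (h * (((smul R ξ).b : ℝ) - b) / (2 * (smul R ξ).a)) =
      ex (h * (ξ 0 1 : ℝ) / (ξ 0 0)) *
        ex (h * (((R.b : ℝ) * ξ 0 0 + 2 * R.c * ξ 1 0) / (2 * (ξ 0 0 : ℝ) * (smul R ξ).a)) -
          h * (b : ℝ) / (2 * (smul R ξ).a)) := by
  rw [← ex_add]
  congr 1
  have hd := hooley_div R ξ hα hA'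
  have hAr : (((smul R ξ).a : ℤ) : ℝ) ≠ 0 := by exact_mod_cast hA'
  have e1 : (h : ℝ) * (((smul R ξ).b : ℝ) - b) / (2 * (smul R ξ).a) =
      h * (((smul R ξ).b : ℝ) / (2 * (smul R ξ).a)) - h * (b : ℝ) / (2 * (smul R ξ).a) := by
    field_simp
  rw [e1, hd]; ring

/-- The Bézout entries of `colMatrix α γ`: `γ · gcdB(α, γ) ≡ 1 (mod α)`, so the upper-right entry
`β = −gcdB(α, γ)` satisfies `β ≡ −γ⁻¹ (mod α)` — the phase `e(hβ/α)` is `e(−hγ̄/α)`. [folklore] -/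
theorem col_mul_gcdB_modEq (α γ : ℤ) (hg : Int.gcd α γ = 1) : γ * Int.gcdB α γ ≡ 1 [ZMOD α] := by
  have := Int.gcd_eq_gcd_ab α γ
  rw [hg] at this; push_cast at this
  rw [Int.modEq_iff_dvd]
  exact ⟨Int.gcdA α γ, by linear_combination this⟩

/-- The upper-right entry of `colMatrix`. [folklore] -/
@[simp] theorem colMatrix_apply_01 (u e : ℤ) (h : Int.gcd u e = 1) :
    colMatrix u e h 0 1 = -Int.gcdB u e := rfl

/-- `e(hβ/α)` only depends on `β mod α`: replacing `β` by any `β' ≡ β (mod α)`. [folklore] -/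
theorem ex_div_congr {α β β' : ℤ} (hα : α ≠ 0) (h : ℤ) (hββ : β ≡ β' [ZMOD α]) :
    ex (h * (β : ℝ) / α) = ex (h * (β' : ℝ) / α) := by
  obtain ⟨k, hk⟩ := Int.modEq_iff_dvd.1 hββ.symm
  have hαr : (α : ℝ) ≠ 0 := by exact_mod_cast hα
  have : (h : ℝ) * (β : ℝ) / α = h * (β' : ℝ) / α + ((h * k : ℤ) : ℝ) := by
    have e : (β : ℝ) = β' + α * k := by
      have := congrArg (fun z : ℤ => (z : ℝ)) hk; push_cast at this; linarith
    rw [e]; push_cast; field_simp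
  rw [this, ex_add_int]

/-! ### The weight of the Weyl sum on forms and on `SL₂(ℤ)` -/

section weight

variable {a b : ℤ} {d N : ℕ} {h : ℤ} {G : ℕ → ℂ}

/-- The weight carried by a form `Q = [A, B, C]` in the Weyl sum at level `ad`:
`[ad ∣ A, 0 < A ≤ aN] · G(A/a) e(h(B − b)/2A)`. [cite: Ngo2024, §3.2 Lemma 3.3] -/
def weylWeight (a b : ℤ) (d N : ℕ) (h : ℤ) (G : ℕ → ℂ) (Q : BinQF) : ℂ :=
  if ((a.toNat * d : ℕ) : ℤ) ∣ Q.a ∧ 0 < Q.a ∧ Q.a ≤ a * N then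
    G (index a Q) * ex (h * ((Q.b : ℝ) - b) / (2 * Q.a))
  else 0

/-- **`T`-invariance**: `w(Q·T^j) = w(Q)` (`B ↦ B + 2Aj` changes the phase by `e(hj) = 1`).
[folklore] -/
theorem weylWeight_smul_T_zpow (Q : BinQF) (j : ℤ) :
    weylWeight a b d N h G (smul Q (T ^ j)) = weylWeight a b d N h G Q := by
  unfold weylWeight
  rw [smul_T_zpow]
  simp only
  split_ifs with hc
  · congr 1
    have hA : (Q.a : ℝ) ≠ 0 := by
      have : Q.a ≠ 0 := hc.2.1.ne'
      exact_mod_cast this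
    have : (h : ℝ) * (((Q.b + 2 * Q.a * j : ℤ) : ℝ) - b) / (2 * Q.a) =
        h * ((Q.b : ℝ) - b) / (2 * Q.a) + ((h * j : ℤ) : ℝ) := by
      push_cast; field_simp; ring
    rw [this, ex_add_int]
  · rfl

/-- The weight pulled back to `SL₂(ℤ)` through the base form: `W_R(ξ) = w(R·ξ)`.
[cite: Ngo2024, §3.4 Corollary 3.13] -/
def weylWeightSL (a b : ℤ) (d N : ℕ) (h : ℤ) (G : ℕ → ℂ) (R : BinQF) (ξ : SL(2, ℤ)) : ℂ :=
  weylWeight a b d N h G (smul R ξ)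

/-- `W_R` is invariant under the automorphs on the left. [folklore] -/
theorem weylWeightSL_stab_mul {g : SL(2, ℤ)} (hg : g ∈ stab R) (ξ : SL(2, ℤ)) :
    weylWeightSL a b d N h G R (g * ξ) = weylWeightSL a b d N h G R ξ := by
  rw [weylWeightSL, weylWeightSL, smul_mul, mem_stab_iff.1 hg]

/-- `W_R` is invariant under `⟨T⟩` on the right. [folklore] -/
theorem weylWeightSL_mul_T_zpow (R : BinQF) (ξ : SL(2, ℤ)) (j : ℤ) :
    weylWeightSL a b d N h G R (ξ * T ^ j) = weylWeightSL a b d N h G R ξ := by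
  rw [weylWeightSL, weylWeightSL, smul_mul, weylWeight_smul_T_zpow]

end weight

/-! ### The shift killing `α = 0` -/

/-- The canonical shift `m_R = ⌊log|θ₊/θ₋| / log κ₁⁻¹⌋ + 1`: with it Tóth's weight vanishes on
the matrices with `α = 0` (whose transport factor is `θ₊/θ₋`). [folklore] -/
def tothShift (R : BinQF) (g₁ : SL(2, ℤ)) : ℤ :=
  ⌊Real.log |rootPlus R / rootMinus R| / Real.log (deckFactor R g₁)⁻¹⌋ + 1

/-- A matrix with `α = 0` has `γ = ±1` and transport factor `θ₊/θ₋`. [folklore] -/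
theorem deckFactor_of_apply_00_eq_zero {ξ : SL(2, ℤ)} (h0 : ξ 0 0 = 0) :
    deckFactor R ξ = rootPlus R / rootMinus R := by
  have hdet : ξ 0 0 * ξ 1 1 - ξ 0 1 * ξ 1 0 = 1 := by
    have h := ξ.det_coe; rwa [Matrix.det_fin_two] at h
  rw [h0, zero_mul, zero_sub] at hdet
  have hγ : ξ 1 0 = 1 ∨ ξ 1 0 = -1 :=
    Int.eq_one_or_neg_one_of_mul_eq_one (by linear_combination hdet : ξ 1 0 * (-ξ 0 1) = 1)
  rw [deckFactor, h0]
  rcases hγ with h | h <;> rw [h] <;> push_cast <;> ring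

/-- **With the canonical shift, `ψ_R(ξ) = 0` when `α = 0`.** [folklore] -/
theorem tothWeight_eq_zero_of_col (R : BinQF) (g₁ : SL(2, ℤ)) {ξ : SL(2, ℤ)} (h0 : ξ 0 0 = 0) :
    tothWeight R g₁ (tothShift R g₁) ξ = 0 := by
  rw [tothWeight, deckFactor_of_apply_00_eq_zero h0, tothShift]
  apply unitPartition_of_nonpos
  set s := Real.log |rootPlus R / rootMinus R| / Real.log (deckFactor R g₁)⁻¹
  have := Int.floor_le s
  have h2 := Int.lt_floor_add_one s
  push_cast
  linarith

/-! ### The fibre of the Weyl sum over an orbit representative -/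

section fibre

variable {a b c : ℤ} {d N : ℕ} {h : ℤ} {G : ℕ → ℂ}

/-- Level forms at level `ad` are level forms at level `a`. [folklore] -/
theorem isLevelForm_base {Q : BinQF}
    (hQ : IsLevelForm a b (discrim a b c) (a.toNat * d) Q) :
    IsLevelForm a b (discrim a b c) a.toNat Q := by
  refine ⟨hQ.disc_eq, ?_, hQ.mid_dvd⟩
  have h1 := hQ.level_dvd
  have : ((a.toNat : ℕ) : ℤ) ∣ ((a.toNat * d : ℕ) : ℤ) := by
    exact_mod_cast Nat.dvd_mul_right a.toNat d
  exact this.trans h1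

/-- `a ∣ a.toNat` as integers (for `a > 0` they are equal). [folklore] -/
theorem dvd_toNat_cast (ha : 0 < a) : a ∣ ((a.toNat : ℕ) : ℤ) := by
  rw [Int.toNat_of_nonneg ha.le]

/-- A representative of a `Γ₀(a)`-orbit met by the Weyl sum is a level form at level `a`.
[folklore] -/
theorem isLevelForm_of_levelEquiv (ha : 0 < a) {Q₀ R : BinQF}
    (hQ₀ : IsLevelForm a b (discrim a b c) a.toNat Q₀) (hRQ : LevelEquiv a.toNat R Q₀) :
    IsLevelForm a b (discrim a b c) a.toNat R := by
  obtain ⟨γ, hγ, hγQ⟩ := hRQ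
  have := hQ₀.smul_inv (dvd_toNat_cast ha) hγ
  rwa [← hγQ, smul_mul_inv] at this

/-- **The orbit `tsum` of the weight is the fibre of the Weyl sum.**  For `R = orbitRep a Q₀`,
`Q₀ ∈ levelFormsUpTo a b c d N`:
`∑'_{Q ∈ TRedOrbit R a} W_R(ξ_Q) = ∑_{Q ∈ levelFormsUpTo, orbitRep a Q = R} G(A/a) e(h(B − b)/2A)`.
[cite: Ngo2024, §3.2 Lemma 3.3, §3.4 Corollary 3.13] -/
theorem tsum_weylWeightSL_lift_eq (ha : 0 < a) {Q₀ : BinQF}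
    (hQ₀ : Q₀ ∈ levelFormsUpTo a b c d N) {R : BinQF} (hR : orbitRep a.toNat Q₀ = R) :
    ∑' Q : TRedOrbit R a.toNat, weylWeightSL a b d N h G R Q.lift =
      ∑ Q ∈ (levelFormsUpTo a b c d N).filter (fun Q => orbitRep a.toNat Q = R),
        G (index a Q) * ex (h * ((Q.b : ℝ) - b) / (2 * Q.a)) := by
  classical
  obtain ⟨hQ₀lev, hQ₀A, hQ₀le, hQ₀T⟩ := (mem_levelFormsUpTo ha).1 hQ₀
  have hRQ : LevelEquiv a.toNat R Q₀ := hR ▸ levelEquiv_orbitRep Q₀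
  have hRrep : orbitRep a.toNat R = R := by rw [← hR]; exact orbitRep_orbitRep Q₀
  have hRlev : IsLevelForm a b (discrim a b c) a.toNat R :=
    isLevelForm_of_levelEquiv ha (isLevelForm_base hQ₀lev) hRQ
  -- rewrite the `tsum` over the subtype as a `tsum` of an indicator over all forms
  have e1 : (∑' Q : TRedOrbit R a.toNat, weylWeightSL a b d N h G R Q.lift) =
      ∑' Q : TRedOrbit R a.toNat, weylWeight a b d N h G Q.1 := by
    refine tsum_congr fun Q => ?_
    rw [weylWeightSL, Q.smul_lift]
  have e2 : (∑' Q : TRedOrbit R a.toNat, weylWeight a b d N h G Q.1) =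
      ∑' Q : BinQF, Set.indicator {Q | IsTReduced Q ∧ LevelEquiv a.toNat R Q}
        (weylWeight a b d N h G) Q :=
    tsum_subtype {Q | IsTReduced Q ∧ LevelEquiv a.toNat R Q} (weylWeight a b d N h G)
  rw [e1, e2, tsum_eq_sum (s := (levelFormsUpTo a b c d N).filter (fun Q => orbitRep a.toNat Q = R))]
  · refine Finset.sum_congr rfl fun Q hQ => ?_
    rw [Finset.mem_filter] at hQ
    obtain ⟨hQlev, hQA, hQle, hQT⟩ := (mem_levelFormsUpTo ha).1 hQ.1
    have hmem : Q ∈ {Q | IsTReduced Q ∧ LevelEquiv a.toNat R Q} :=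
      ⟨hQT, by have := levelEquiv_orbitRep (q := a.toNat) Q; rwa [hQ.2] at this⟩
    rw [Set.indicator_of_mem hmem, weylWeight, if_pos ⟨hQlev.level_dvd, hQA, hQle⟩]
  · intro Q hQ
    by_cases hmem : Q ∈ {Q | IsTReduced Q ∧ LevelEquiv a.toNat R Q}
    · rw [Set.indicator_of_mem hmem, weylWeight]
      obtain ⟨hQT, hQR⟩ := hmem
      rw [if_neg]
      rintro ⟨hdvd, hApos, hAle⟩
      apply hQ
      -- `Q` is a level form at level `a` (the orbit of `R`), hence at level `ad`, in the range
      have hQa : IsLevelForm a b (discrim a b c) a.toNat Q := by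
        obtain ⟨γ, hγ, rfl⟩ := hQR
        exact hRlev.smul (dvd_toNat_cast ha) hγ
      have hQlev : IsLevelForm a b (discrim a b c) (a.toNat * d) Q := ⟨hQa.disc_eq, hdvd, hQa.mid_dvd⟩
      rw [Finset.mem_filter, mem_levelFormsUpTo ha]
      exact ⟨⟨hQlev, hApos, hAle, hQT⟩, by rw [← orbitRep_eq_of_levelEquiv hQR, hRrep]⟩
    · exact Set.indicator_of_notMem hmem _

/-- Finitely many `T`-reduced forms of a given discriminant have `0 < A ≤ M` (`B ∈ [0, 2A)` and
`C = (B² − Δ)/4A`). [folklore] -/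
theorem finite_isTReduced_of_a_le (Δ M : ℤ) :
    {Q : BinQF | IsTReduced Q ∧ Q.disc = Δ ∧ 0 < Q.a ∧ Q.a ≤ M}.Finite := by
  have hbox : (Set.Icc 1 M ×ˢ Set.Icc 0 (2 * M) : Set (ℤ × ℤ)).Finite :=
    (Set.finite_Icc _ _).prod (Set.finite_Icc _ _)
  refine Set.Finite.of_finite_image (f := fun Q : BinQF => (Q.a, Q.b)) (hbox.subset ?_) ?_
  · rintro _ ⟨Q, ⟨hT, -, hA, hle⟩, rfl⟩
    obtain ⟨hb0, hb⟩ := hT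
    rw [abs_of_pos hA] at hb
    simp only [Set.mem_prod, Set.mem_Icc]
    exact ⟨⟨hA, hle⟩, hb0, by linarith⟩
  · rintro Q ⟨-, hQ, hA, -⟩ Q' ⟨-, hQ', hA', -⟩ h
    simp only [Prod.mk.injEq] at h
    obtain ⟨ha, hb⟩ := h
    have hc : Q.c = Q'.c := by
      have e1 : 4 * Q.a * Q.c = Q.b ^ 2 - Δ := by rw [← hQ, BinQF.disc]; ring
      have e2 : 4 * Q'.a * Q'.c = Q'.b ^ 2 - Δ := by rw [← hQ', BinQF.disc]; ring
      rw [ha, hb, ← e2] at e1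
      have h4 : (4 * Q'.a) ≠ 0 := mul_ne_zero (by norm_num) hA'.ne'
      exact mul_left_cancel₀ h4 e1
    exact BinQF.ext ha hb hc

/-- The support of `Q ↦ W_R(ξ_Q)` on the orbit is finite. [folklore] -/
theorem finite_support_weylWeightSL (R : BinQF) :
    (Function.support fun Q : TRedOrbit R a.toNat => weylWeightSL a b d N h G R Q.lift).Finite := by
  apply Set.Finite.subset (s := {Q : TRedOrbit R a.toNat |
      Q.1 ∈ {Q : BinQF | IsTReduced Q ∧ Q.disc = R.disc ∧ 0 < Q.a ∧ Q.a ≤ a * N}})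
  · apply Set.Finite.preimage (f := fun Q : TRedOrbit R a.toNat => Q.1)
    · exact Subtype.val_injective.injOn
    · exact finite_isTReduced_of_a_le _ _
  · intro Q hQ
    rw [Function.mem_support, weylWeightSL, Q.smul_lift, weylWeight] at hQ
    split_ifs at hQ with hc
    · refine ⟨Q.isTReduced, ?_, hc.2.1, hc.2.2⟩
      obtain ⟨γ, -, hγQ⟩ := Q.2.2
      rw [← hγQ, smul_disc]
    · exact absurd rfl hQ

end fibre

/-! ### The Weyl sum as a sum of Tóth-weighted sums -/

section assembly

variable {a b c : ℤ} {d N : ℕ}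

/-- **The Weyl sum for the roots of `f = ax² + bx + c`, `Δ > 0`, in Tóth's form** (Ngo, Lemma 3.3 and
Corollary 3.13, first-column conventions).  For `a > 0`, non-square `Δ = b² − 4ac > 0`, a level
`d`, a weight `G` and a frequency `h`:

  `∑_{n ≤ N, d ∣ n} G(n) ∑_{f(ν) ≡ 0 (n)} e(hν/n) = ∑_{R} ½ ∑'_{(α,γ) coprime, a ∣ γ} W_R(ξ_{(α,γ)}) ψ_R(ξ_{(α,γ)})`,

`R` over the representatives of the `Γ₀(a)`-orbits met by the level forms,
`W_R = weylWeightSL a b d N h G R` (`[ad ∣ A', 0 < A' ≤ aN] G(A'/a) e(h(B' − b)/2A')`) and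
`ψ_R = tothWeight R (g R) (m R)` for any deck generators `g R` of `stab_a(R)` (they exist:
`exists_toth_generators`) and any shifts `m R`. [cite: Ngo2024, §3.2 Lemma 3.3, §3.4 Corollary 3.13; Toth2000, main theorem] -/
theorem weylSum_eq_sum_tothSum (ha : 0 < a) (hΔ : 0 < discrim a b c)
    (hsq : ¬ IsSquare (discrim a b c)) (h : ℤ) (G : ℕ → ℂ) (m : BinQF → ℤ) (g : BinQF → SL(2, ℤ))
    (hg : ∀ R ∈ (levelFormsUpTo a b c d N).image (orbitRep a.toNat),
      g R ∈ stabLevel R a.toNat ∧ deckFactor R (g R) < 1 ∧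
        ∀ s ∈ stabLevel R a.toNat, ∃ k : ℤ, s = g R ^ k ∨ s = -g R ^ k) :
    ∑ n ∈ (Finset.Icc 1 N).filter (d ∣ ·),
        G n * polyRootWeylSum (C a * X ^ 2 + C b * X + C c) n h =
      ∑ R ∈ (levelFormsUpTo a b c d N).image (orbitRep a.toNat),
        (1 / 2 : ℂ) * ∑' v : PrimVec a.toNat,
          weylWeightSL a b d N h G R v.toSL * (tothWeight R (g R) (m R) v.toSL : ℂ) := by
  classical
  rw [sum_weylSum_eq_sum_levelForms ha b c d N h G]
  simp_rw [exp_phase_eq_ex]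
  rw [← Finset.sum_fiberwise_of_maps_to (g := orbitRep a.toNat)
    (t := (levelFormsUpTo a b c d N).image (orbitRep a.toNat))
    (fun Q hQ => Finset.mem_image_of_mem _ hQ)]
  refine Finset.sum_congr rfl fun R hR => ?_
  obtain ⟨Q₀, hQ₀, hRQ₀⟩ := Finset.mem_image.1 hR
  rw [← tsum_weylWeightSL_lift_eq (h := h) (G := G) ha hQ₀ hRQ₀]
  -- the representative: `A ≠ 0`, non-square `Δ > 0`
  obtain ⟨hQ₀lev, -, -, -⟩ := (mem_levelFormsUpTo ha).1 hQ₀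
  have hRQ : LevelEquiv a.toNat R Q₀ := hRQ₀ ▸ levelEquiv_orbitRep Q₀
  have hRlev : IsLevelForm a b (discrim a b c) a.toNat R :=
    isLevelForm_of_levelEquiv ha (isLevelForm_base hQ₀lev) hRQ
  have hRΔ : 0 < R.disc := by rw [hRlev.disc_eq]; exact hΔ
  have hRsq : ¬ IsSquare R.disc := by rw [hRlev.disc_eq]; exact hsq
  have hRA : R.a ≠ 0 := a_ne_zero_of_not_isSquare hRsq
  obtain ⟨hgR, hκR, hgenR⟩ := hg R hR
  rw [tsum_primVec_mul_tothWeight hRA hRΔ hRsq hgR hκR hgenR (m R)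
    (W := weylWeightSL a b d N h G R) (fun s hs ξ => weylWeightSL_stab_mul hs.1 ξ)
    (fun ξ j => weylWeightSL_mul_T_zpow R ξ j) (finite_support_weylWeightSL R)]
  ring

/-- **Deck generators exist for all representatives** (`stab_a(R) = {±(g R)^k}`, `κ(R, g R) < 1`).
[cite: Toth2000, main theorem (cf. Ngo2024 §3.2 (3.10): `Γ^{(j)} = {±T₀ⁿ}`)] -/
theorem exists_toth_generators (ha : 0 < a) (hΔ : 0 < discrim a b c)
    (hsq : ¬ IsSquare (discrim a b c)) :
    ∃ g : BinQF → SL(2, ℤ),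
      ∀ R ∈ (levelFormsUpTo a b c d N).image (orbitRep a.toNat),
        g R ∈ stabLevel R a.toNat ∧ deckFactor R (g R) < 1 ∧
          ∀ s ∈ stabLevel R a.toNat, ∃ k : ℤ, s = g R ^ k ∨ s = -g R ^ k := by
  classical
  haveI : NeZero a.toNat := ⟨by omega⟩
  have key : ∀ R ∈ (levelFormsUpTo a b c d N).image (orbitRep a.toNat),
      R.a ≠ 0 ∧ 0 < R.disc ∧ ¬ IsSquare R.disc := by
    intro R hR
    obtain ⟨Q₀, hQ₀, hRQ₀⟩ := Finset.mem_image.1 hR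
    obtain ⟨hQ₀lev, -, -, -⟩ := (mem_levelFormsUpTo ha).1 hQ₀
    have hRQ : LevelEquiv a.toNat R Q₀ := hRQ₀ ▸ levelEquiv_orbitRep Q₀
    have hRlev : IsLevelForm a b (discrim a b c) a.toNat R :=
      isLevelForm_of_levelEquiv ha (isLevelForm_base hQ₀lev) hRQ
    have hRsq : ¬ IsSquare R.disc := by rw [hRlev.disc_eq]; exact hsq
    exact ⟨a_ne_zero_of_not_isSquare hRsq, by rw [hRlev.disc_eq]; exact hΔ, hRsq⟩
  refine ⟨fun R => if hR : R.a ≠ 0 ∧ 0 < R.disc ∧ ¬ IsSquare R.disc then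
      Classical.choose (exists_deck_generator hR.1 hR.2.1 hR.2.2 a.toNat) else 1, ?_⟩
  intro R hR
  have hk := key R hR
  simp only [dif_pos hk]
  exact Classical.choose_spec (exists_deck_generator hk.1 hk.2.1 hk.2.2 a.toNat)

end assembly

end RootForms

end Literature.NumberTheory.Sieve
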